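import Summits.CriticalPhenomena.PercolationContinuityZ3.Theorems.PercNearOneGluingNoHeavyQuantBlobLawSizeBias
import HarnessLib

/-!
# QUANT lane R8, T-DEC: HOEFFDING'S THREE-VALUE REDUCTION, part 1 — the pair identity and the potential of the recursion
# (prim-quant-census-2 gen 83, file 1/3)

builds on p205010 (kernel theorem, internal audit signed; external expert review pending)

Support file (`--supports stmt-CriticalPhenomena-4575`), QUANT lane census seat prim-quant-census-2 (gen 83); memo
`run/shared/lean/prim/quant/prim-quant-census-2-g83/HOEFFDING-G83.md`.  Theorems only, standard axioms, no sorries, no definitions.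

THE TOOL the census-2 lineage was missing (REFLECTION-G82.md §4 and the lineage's terminal HANDOFF: "an extremality principle for Poisson-binomial
laws").  For two blobs of a common size `k` with gates `a, b` in front of any blob list `W` the law is SYMMETRIC AND MULTI-AFFINE in `(a, b)`:
`P = X − (a+b)(X − Y) + ab(X − 2Y + Z)` (`blobLaw_pair_expand`), hence AFFINE IN THE PRODUCT `ab` at fixed `a + b`, and
`P_{a,b} = θ·P_{a₁,b₁} + (1−θ)·P_{a₂,b₂}` whenever `a₁+b₁ = a₂+b₂ = a+b` and `ab = θ·a₁b₁ + (1−θ)·a₂b₂` (`blobLaw_pair_mix`).  The three-value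
recursion (file 2/3, `…QuantHoeffdingMixture`) replaces two interior gates `a < m̄ < b` (`m̄` = the mean of the gates lying strictly inside `(0,1)`)
by the mixture of `(m̄, a+b−m̄)` (EQUALIZING move) and `(0, a+b)` or `(1, a+b−1)` (BOUNDARY move); this file proves that both moves lower the
potential `(|G|+1)·#{interior gates} + #{interior gates ≠ m̄}`:
* `blobLaw_pair_expand`, `blobLaw_pair_mix` — the pair identity.
* `sum_le_length_mul`, `length_mul_le_sum`, `sum_lt_length_mul`, `length_mul_lt_sum`, `mem_int_iff`, `imean_mem` (the interior mean lies in
  `(0,1)`), `exists_above_imean` / `exists_below_imean` / **`exists_pair_around_imean`** (if some interior gate differs from the interior mean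
  there are interior gates `a < m̄ < b`), `pot_perm` (permutation invariance).
* `int_cons_of_mem`, `int_cons_of_not`, `filter_ne_cons_self`, `filter_ne_cons_of_ne`, `length_filter_cons_le` — filter bookkeeping.
* **`pot_equalize_lt`**, **`pot_boundary_lt`** — the two moves lower the potential.

HONEST STATUS.  Tool only; conjecture BLOB-AFL in the middle band beyond width 4, conjecture C, `SiblingStep`, `FarTreeRow`, `GluedLemmaW`,
`GluedDominatedMass` OPEN; RATE class (log\*) / honest sentence of `run/shared/lean/prim/quant/README.md` unchanged.  [this work].  The
three-value phenomenon is classical [cite: Hoeffding1956, Theorem 5] (extrema of `E f(S)` at fixed `ES` over independent trials are attained at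
gate vectors with at most one value outside `{0,1}`); it is NOT used as a cited fact — everything here is proved from the definitions.  The gluing
rows served [cite: KozmaNitzan2024, Conjecture 3 (p. 15)]; product measure [cite: Grimmett1999, §1.3 p. 10].
-/

noncomputable section

open scoped BigOperators

namespace Summit.CriticalPhenomena.PercolationContinuityZ3.Theorems
namespace Quant

open Finset

/-- the blob list of a gate list at the common blob size `k` -/
local notation3 "BL[" k ", " G "]" => LawDec.blobLaw (List.map (fun g : ℝ => ((k : ℕ), g)) G)

/-- the gates of `G` lying strictly inside `(0,1)` -/
local notation3 "INT[" G "]" => List.filter (fun x : ℝ => decide (0 < x ∧ x < 1)) (G : List ℝ)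

/-- the mean of the interior gates of `G` -/
local notation3 "IMEAN[" G "]" => (List.sum INT[G]) / ((List.length INT[G] : ℕ) : ℝ)

/-- the interior gates of `G` different from their mean -/
local notation3 "BAD[" G "]" => List.filter (fun x : ℝ => decide (x ≠ IMEAN[G])) INT[G]

/-- the potential `(|G|+1)·#interior + #(interior ≠ mean)` -/
local notation3 "POT[" G "]" => ((List.length (G : List ℝ)) + 1) * List.length INT[G] + List.length BAD[G]

namespace LawDec

/-! ### 1. Two equal blobs in front of a list: the law is symmetric and multi-affine in their gates -/

/-- **PAIR EXPANSION.**  `P_{(k,a)::(k,b)::W}(h) = X − (a+b)(X − Y) + ab(X − 2Y + Z)` with `X = P_W(h)`, `Y = P_W(h−k)[k ≤ h]`,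
`Z = P_W(h−2k)[2k ≤ h]`. [this work] -/
theorem blobLaw_pair_expand (k : ℕ) (a b : ℝ) (W : List (ℕ × ℝ)) (h : ℕ) :
    blobLaw ((k, a) :: (k, b) :: W) h =
      blobLaw W h - (a + b) * (blobLaw W h - (if k ≤ h then blobLaw W (h - k) else 0))
        + a * b * (blobLaw W h - 2 * (if k ≤ h then blobLaw W (h - k) else 0)
            + (if k ≤ h then (if k ≤ h - k then blobLaw W (h - k - k) else 0) else 0)) := by
  simp only [blobLaw, slice]
  split_ifs <;> ring

/-- **PAIR MIXING.**  At a fixed gate sum the law is affine in the gate product: if `a₁ + b₁ = a₂ + b₂ = a + b` and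
`ab = θ·a₁b₁ + (1−θ)·a₂b₂` then `P_{a,b,W} = θ·P_{a₁,b₁,W} + (1−θ)·P_{a₂,b₂,W}` pointwise. [this work] -/
theorem blobLaw_pair_mix (k : ℕ) (a b a₁ b₁ a₂ b₂ θ : ℝ) (W : List (ℕ × ℝ)) (hs₁ : a₁ + b₁ = a + b) (hs₂ : a₂ + b₂ = a + b)
    (hp : a * b = θ * (a₁ * b₁) + (1 - θ) * (a₂ * b₂)) (h : ℕ) :
    blobLaw ((k, a) :: (k, b) :: W) h = θ * blobLaw ((k, a₁) :: (k, b₁) :: W) h + (1 - θ) * blobLaw ((k, a₂) :: (k, b₂) :: W) h := by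
  rw [blobLaw_pair_expand k a b, blobLaw_pair_expand k a₁ b₁, blobLaw_pair_expand k a₂ b₂]
  linear_combination (blobLaw W h - (if k ≤ h then blobLaw W (h - k) else 0)) * θ * hs₁
    + (blobLaw W h - (if k ≤ h then blobLaw W (h - k) else 0)) * (1 - θ) * hs₂
    + (blobLaw W h - 2 * (if k ≤ h then blobLaw W (h - k) else 0)
        + (if k ≤ h then (if k ≤ h - k then blobLaw W (h - k - k) else 0) else 0)) * hp

/-! ### 3. Interior gates, their mean, and the potential of the three-value recursion -/

/-- `Σ l ≤ |l|·c` when every entry is `≤ c`. [folklore] -/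
theorem sum_le_length_mul (c : ℝ) : ∀ l : List ℝ, (∀ x ∈ l, x ≤ c) → l.sum ≤ (l.length : ℝ) * c
  | [], _ => by simp
  | a :: l, h => by
    rw [List.sum_cons, List.length_cons]
    push_cast
    have := sum_le_length_mul c l fun x hx => h x (List.mem_cons_of_mem a hx)
    linarith [h a List.mem_cons_self]

/-- `|l|·c ≤ Σ l` when every entry is `≥ c`. [folklore] -/
theorem length_mul_le_sum (c : ℝ) : ∀ l : List ℝ, (∀ x ∈ l, c ≤ x) → (l.length : ℝ) * c ≤ l.sum
  | [], _ => by simp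
  | a :: l, h => by
    rw [List.sum_cons, List.length_cons]
    push_cast
    have := length_mul_le_sum c l fun x hx => h x (List.mem_cons_of_mem a hx)
    linarith [h a List.mem_cons_self]

/-- `Σ l < |l|·c` when every entry of a nonempty list is `< c`. [folklore] -/
theorem sum_lt_length_mul (c : ℝ) : ∀ l : List ℝ, l ≠ [] → (∀ x ∈ l, x < c) → l.sum < (l.length : ℝ) * c
  | [], h, _ => absurd rfl h
  | a :: l, _, h => by
    rw [List.sum_cons, List.length_cons]
    push_cast
    have := sum_le_length_mul c l fun x hx => (h x (List.mem_cons_of_mem a hx)).le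
    linarith [h a List.mem_cons_self]

/-- `|l|·c < Σ l` when every entry of a nonempty list is `> c`. [folklore] -/
theorem length_mul_lt_sum (c : ℝ) : ∀ l : List ℝ, l ≠ [] → (∀ x ∈ l, c < x) → (l.length : ℝ) * c < l.sum
  | [], h, _ => absurd rfl h
  | a :: l, _, h => by
    rw [List.sum_cons, List.length_cons]
    push_cast
    have := length_mul_le_sum c l fun x hx => (h x (List.mem_cons_of_mem a hx)).le
    linarith [h a List.mem_cons_self]

/-- membership in the interior filter. -/
theorem mem_int_iff (G : List ℝ) (x : ℝ) : x ∈ INT[G] ↔ x ∈ G ∧ 0 < x ∧ x < 1 := by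
  rw [List.mem_filter, decide_eq_true_eq]

/-- the mean of the interior gates lies in `(0,1)` as soon as there is one. [this work] -/
theorem imean_mem (G : List ℝ) (hne : INT[G] ≠ []) : 0 < IMEAN[G] ∧ IMEAN[G] < 1 := by
  have hlen : (0 : ℝ) < (List.length INT[G] : ℕ) := by
    exact_mod_cast List.length_pos_of_ne_nil hne
  have h1 := length_mul_lt_sum 0 INT[G] hne fun x hx => ((mem_int_iff G x).1 hx).2.1
  have h2 := sum_lt_length_mul 1 INT[G] hne fun x hx => ((mem_int_iff G x).1 hx).2.2
  rw [mul_zero] at h1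
  rw [mul_one] at h2
  exact ⟨div_pos h1 hlen, (div_lt_one hlen).2 h2⟩

/-- if an interior gate lies strictly below the interior mean, another lies strictly above it. [this work] -/
theorem exists_above_imean (G : List ℝ) (a : ℝ) (ha : a ∈ INT[G]) (hlt : a < IMEAN[G]) : ∃ b ∈ INT[G], IMEAN[G] < b := by
  classical
  by_contra hcon
  simp only [not_exists, not_and, not_lt] at hcon
  set I := INT[G] with hI
  set m := I.sum / (I.length : ℝ) with hm
  have hperm : I.Perm (a :: I.erase a) := List.perm_cons_erase ha
  have hlen : (I.length : ℝ) = (I.erase a).length + 1 := by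
    rw [hperm.length_eq, List.length_cons]; push_cast; ring
  have hsum : I.sum = a + (I.erase a).sum := by rw [hperm.sum_eq, List.sum_cons]
  have hle : (I.erase a).sum ≤ ((I.erase a).length : ℝ) * m :=
    sum_le_length_mul _ _ fun x hx => hcon x (List.mem_of_mem_erase hx)
  have hpos : (0 : ℝ) < I.length := by exact_mod_cast List.length_pos_of_mem ha
  have hmean : (I.length : ℝ) * m = I.sum := by rw [hm]; field_simp
  have key : ((I.erase a).length : ℝ) * m + m = I.sum := by rw [← hmean, hlen]; ring
  linarith

/-- if an interior gate lies strictly above the interior mean, another lies strictly below it. [this work] -/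
theorem exists_below_imean (G : List ℝ) (b : ℝ) (hb : b ∈ INT[G]) (hlt : IMEAN[G] < b) : ∃ a ∈ INT[G], a < IMEAN[G] := by
  classical
  by_contra hcon
  simp only [not_exists, not_and, not_lt] at hcon
  set I := INT[G] with hI
  set m := I.sum / (I.length : ℝ) with hm
  have hperm : I.Perm (b :: I.erase b) := List.perm_cons_erase hb
  have hlen : (I.length : ℝ) = (I.erase b).length + 1 := by
    rw [hperm.length_eq, List.length_cons]; push_cast; ring
  have hsum : I.sum = b + (I.erase b).sum := by rw [hperm.sum_eq, List.sum_cons]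
  have hle : ((I.erase b).length : ℝ) * m ≤ (I.erase b).sum :=
    length_mul_le_sum _ _ fun x hx => hcon x (List.mem_of_mem_erase hx)
  have hpos : (0 : ℝ) < I.length := by exact_mod_cast List.length_pos_of_mem hb
  have hmean : (I.length : ℝ) * m = I.sum := by rw [hm]; field_simp
  have key : ((I.erase b).length : ℝ) * m + m = I.sum := by rw [← hmean, hlen]; ring
  linarith

/-- **SELECTION.**  If some interior gate differs from the interior mean, there are interior gates `a < IMEAN[G] < b`. [this work] -/
theorem exists_pair_around_imean (G : List ℝ) (hbad : BAD[G] ≠ []) :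
    ∃ a b : ℝ, a ∈ G ∧ b ∈ G ∧ 0 < a ∧ a < IMEAN[G] ∧ IMEAN[G] < b ∧ b < 1 := by
  obtain ⟨x, hx⟩ := List.exists_mem_of_ne_nil _ hbad
  rw [List.mem_filter, decide_eq_true_eq] at hx
  obtain ⟨hxI, hxm⟩ := hx
  rcases lt_or_gt_of_ne hxm with hlt | hgt
  · obtain ⟨b, hbI, hb⟩ := exists_above_imean G x hxI hlt
    have hx' := (mem_int_iff G x).1 hxI
    have hb' := (mem_int_iff G b).1 hbI
    exact ⟨x, b, hx'.1, hb'.1, hx'.2.1, hlt, hb, hb'.2.2⟩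
  · obtain ⟨a, haI, ha⟩ := exists_below_imean G x hxI hgt
    have hx' := (mem_int_iff G x).1 hxI
    have ha' := (mem_int_iff G a).1 haI
    exact ⟨a, x, ha'.1, hx'.1, ha'.2.1, ha, hgt, hx'.2.2⟩

/-- the interior filter, the interior mean and the potential are permutation invariant. [this work] -/
theorem pot_perm {G G' : List ℝ} (h : G.Perm G') : IMEAN[G] = IMEAN[G'] ∧ POT[G] = POT[G'] := by
  have hI : (INT[G]).Perm INT[G'] := h.filter _
  have hmean : IMEAN[G] = IMEAN[G'] := by rw [hI.sum_eq, hI.length_eq]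
  refine ⟨hmean, ?_⟩
  have hB : (BAD[G]).Perm BAD[G'] := by
    rw [hmean]; exact hI.filter _
  rw [hB.length_eq, h.length_eq, hI.length_eq]
/-! ### 4. Filter bookkeeping -/

/-- an interior head survives the interior filter. -/
theorem int_cons_of_mem (x : ℝ) (l : List ℝ) (h : 0 < x ∧ x < 1) : INT[x :: l] = x :: INT[l] := by
  rw [List.filter_cons, if_pos (by simpa using h)]

/-- a non-interior head is dropped by the interior filter. -/
theorem int_cons_of_not (x : ℝ) (l : List ℝ) (h : ¬ (0 < x ∧ x < 1)) : INT[x :: l] = INT[l] := by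
  rw [List.filter_cons, if_neg (by simpa using h)]

/-- the filter `≠ c` drops a head equal to `c`. -/
theorem filter_ne_cons_self (c : ℝ) (l : List ℝ) :
    List.filter (fun x : ℝ => decide (x ≠ c)) (c :: l) = List.filter (fun x : ℝ => decide (x ≠ c)) l := by
  rw [List.filter_cons, if_neg (by simp)]

/-- the filter `≠ c` keeps a head different from `c`. -/
theorem filter_ne_cons_of_ne (c y : ℝ) (l : List ℝ) (h : y ≠ c) :
    List.filter (fun x : ℝ => decide (x ≠ c)) (y :: l) = y :: List.filter (fun x : ℝ => decide (x ≠ c)) l := by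
  rw [List.filter_cons, if_pos (by simpa using h)]

/-- a filter of `x :: l` is at most one longer than the filter of `l`. -/
theorem length_filter_cons_le (p : ℝ → Bool) (x : ℝ) (l : List ℝ) :
    (List.filter p (x :: l)).length ≤ 1 + (List.filter p l).length := by
  rw [List.filter_cons]
  split_ifs
  · rw [List.length_cons]; omega
  · omega
/-! ### 5. The two moves lower the potential -/

/-- **EQUALIZING MOVE.**  Replacing interior gates `a < m̄ < b` by `(m̄, a + b − m̄)` keeps the interior count and the interior mean and
lowers the number of interior gates different from the mean. [this work] -/
theorem pot_equalize_lt (a b : ℝ) (W : List ℝ) (ha0 : 0 < a) (hb1 : b < 1) (ham : a < IMEAN[a :: b :: W])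
    (hmb : IMEAN[a :: b :: W] < b) :
    POT[IMEAN[a :: b :: W] :: (a + b - IMEAN[a :: b :: W]) :: W] < POT[a :: b :: W] := by
  set m := IMEAN[a :: b :: W] with hm
  have ha : 0 < a ∧ a < 1 := ⟨ha0, by linarith⟩
  have hb : 0 < b ∧ b < 1 := ⟨by linarith, hb1⟩
  have hmI : 0 < m ∧ m < 1 := ⟨by linarith, by linarith⟩
  have hcI : 0 < a + b - m ∧ a + b - m < 1 := ⟨by linarith, by linarith⟩
  have hIold : INT[a :: b :: W] = a :: b :: INT[W] := by rw [int_cons_of_mem _ _ ha, int_cons_of_mem _ _ hb]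
  have hInew : INT[m :: (a + b - m) :: W] = m :: (a + b - m) :: INT[W] := by
    rw [int_cons_of_mem _ _ hmI, int_cons_of_mem _ _ hcI]
  -- the interior mean is unchanged
  have hm' : m = (a + (b + List.sum INT[W])) / (((List.length INT[W] + 1 + 1 : ℕ)) : ℝ) := by
    rw [hm, hIold]; simp only [List.sum_cons, List.length_cons]
  have hmean : IMEAN[m :: (a + b - m) :: W] = m := by
    rw [hInew]
    simp only [List.sum_cons, List.length_cons]
    rw [show m + (a + b - m + List.sum INT[W]) = a + (b + List.sum INT[W]) by ring]
    exact hm'.symm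
  -- the bad lists
  have hBold : BAD[a :: b :: W] = a :: b :: List.filter (fun x : ℝ => decide (x ≠ m)) INT[W] := by
    rw [← hm, hIold, filter_ne_cons_of_ne _ _ _ ham.ne, filter_ne_cons_of_ne _ _ _ hmb.ne']
  have hBnew : List.length BAD[m :: (a + b - m) :: W] ≤ 1 + (List.filter (fun x : ℝ => decide (x ≠ m)) INT[W]).length := by
    rw [hmean, hInew, filter_ne_cons_self]
    exact length_filter_cons_le _ _ _
  -- count
  have h4 : List.length BAD[a :: b :: W] = (List.filter (fun x : ℝ => decide (x ≠ m)) INT[W]).length + 2 := by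
    rw [hBold]; simp only [List.length_cons]
  have e1 : (W.length + 1 + 1 + 1) * List.length INT[m :: (a + b - m) :: W]
      = (W.length + 1 + 1 + 1) * (List.length INT[W] + 1 + 1) := by
    rw [hInew]; simp only [List.length_cons]
  have e0 : (W.length + 1 + 1 + 1) * List.length INT[a :: b :: W]
      = (W.length + 1 + 1 + 1) * (List.length INT[W] + 1 + 1) := by
    rw [hIold]; simp only [List.length_cons]
  simp only [List.length_cons]
  linarith

/-- **BOUNDARY MOVE.**  Replacing interior gates `a, b` by `(c₁, c₂)` with `c₁ ∉ (0,1)` lowers the interior count, hence the potential.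
[this work] -/
theorem pot_boundary_lt (a b c₁ c₂ : ℝ) (W : List ℝ) (ha : 0 < a ∧ a < 1) (hb : 0 < b ∧ b < 1) (hc₁ : ¬ (0 < c₁ ∧ c₁ < 1)) :
    POT[c₁ :: c₂ :: W] < POT[a :: b :: W] := by
  have hIold : INT[a :: b :: W] = a :: b :: INT[W] := by rw [int_cons_of_mem _ _ ha, int_cons_of_mem _ _ hb]
  have hInew : INT[c₁ :: c₂ :: W] = INT[c₂ :: W] := int_cons_of_not _ _ hc₁
  have f1 : List.length INT[c₁ :: c₂ :: W] ≤ 1 + List.length INT[W] := by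
    rw [hInew]; exact length_filter_cons_le _ _ _
  have f2 : List.length BAD[c₁ :: c₂ :: W] ≤ List.length INT[c₁ :: c₂ :: W] := List.length_filter_le _ _
  have f3 : List.length INT[W] ≤ W.length := List.length_filter_le _ _
  have e1 : (W.length + 1 + 1 + 1) * List.length INT[c₁ :: c₂ :: W] ≤ (W.length + 1 + 1 + 1) * (1 + List.length INT[W]) :=
    Nat.mul_le_mul_left _ f1
  have e0 : (W.length + 1 + 1 + 1) * List.length INT[a :: b :: W]
      = (W.length + 1 + 1 + 1) * (List.length INT[W] + 1 + 1) := by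
    rw [hIold]; simp only [List.length_cons]
  simp only [List.length_cons]
  have f0 : 0 ≤ List.length BAD[a :: b :: W] := Nat.zero_le _
  linarith

end LawDec
end Quant
end Summit.CriticalPhenomena.PercolationContinuityZ3.Theorems
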